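import Mathlib
import HarnessLib
import Summits.HubbardSuperconductivity.HubbardSuperconductivity.Theorems.KLProgrammeC4aFirstOrderLayerSum
import Summits.HubbardSuperconductivity.HubbardSuperconductivity.Theorems.KLProgrammeC4aPPKernelFirstOrderRows

/-!
# Route `KLProgramme` — crux C4a, S3 brick (B4) «(U1)-HYBRID» kernel side, B-1 (vi) one-call: THE SUMMED FIRST-ORDER LAYER FOR THE TRUE pp KERNEL `P/C_P`

Cell `gate-hubbard-kl`, seat hubbard-kl-k3c3-p1 (g19; row «δμ-flow with klAngularMean constant piece»), owner split (R321)(B): the law chain is k3c3-p3's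
(`…C4aFirstOrderLayerSum.firstOrderLayer_abs_le`, B-1 (vi): umklapp as the integrated hypothesis `hUmk` + tangency + Cooper, ONE two-variable kernel `Kr` read
through the six rows `hKd hKc hK0 hK0s hK1 hKs1`), the kernel side this seat's (`…C4aPPKernelFirstOrderRows`).  **`firstOrderLayer_abs_ppTrue_le`** = that headline with the six
kernel rows DISCHARGED for the concrete kernel below; every other binder (Sizes, `FrameOK`, `GeomConstants`, the two-node / Cooper windows, the dominator `hdom`, the
weight and Jacobian rows, `hUmk`) is the law's, verbatim.
Pure composition of landed theorems; nothing asserts (C), K3, the window or superconductivity.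
References: BGM 2006 §2.4 (2.36) [cite: BenfattoGiulianiMastropietro2006]; FST II CPAM 51 (1998) §3 [cite: FeldmanSalmhoferTrubowitz1998].
-/

noncomputable section

namespace Summit.HubbardSuperconductivity.HubbardSuperconductivity.Theorems.C4a

set_option linter.dupNamespace false -- summit = problem name (single-conjunct summit), D-0017

open Real Set Filter MeasureTheory intervalIntegral
open scoped Topology
open Literature.MathematicalPhysics.QuantumLattice Literature.MathematicalPhysics.QuantumLattice.BandSectorCounting Literature.Probability.LatticeModels
open Literature.MathematicalPhysics.QuantumLattice.FermiRG Literature.Analysis.SpecialFunctions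
open Summit.HubbardSuperconductivity.HubbardSuperconductivity.Theorems.KLRegimeSplit
open Summit.HubbardSuperconductivity.HubbardSuperconductivity.Theorems.DispersionFlow
open Summit.HubbardSuperconductivity.HubbardSuperconductivity.Theorems.PerturbedFermiCurve

section Sizes

variable {K : TrigPolyC4v} {A : ℝ} (hA : ∀ p : Momentum, ∀ j ≤ 2, ‖iteratedFDeriv ℝ j (frameShift K) p‖ ≤ A) (hA20 : A ≤ 1 / 20)
  (hd : klCurveD ≤ (bandBounds (show (-4 : ℝ) < -1.1 by norm_num) (show (-1.1 : ℝ) ≤ -0.1 by norm_num) (show (-0.1 : ℝ) < 0 by norm_num)).Dtmin - 2 * A)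
  {μ r : ℝ} (hr : 0 < r) (hlo : (-1.1 : ℝ) < μ - r - A) (hhi : μ + r + A < -0.1)
  {A₃ A₄ A₅ A₆ : ℝ} (hA₃ : ∀ p : Momentum, ‖iteratedFDeriv ℝ 3 (frameShift K) p‖ ≤ A₃)
  (hA₄ : ∀ p : Momentum, ‖iteratedFDeriv ℝ 4 (frameShift K) p‖ ≤ A₄)
  (hA₅ : ∀ p : Momentum, ‖iteratedFDeriv ℝ 5 (frameShift K) p‖ ≤ A₅)
  (hA₆ : ∀ p : Momentum, ‖iteratedFDeriv ℝ 6 (frameShift K) p‖ ≤ A₆)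
  {K₁ K₂ K₃ : ℝ} (hK₁ : ∀ p : Momentum, ‖fderiv ℝ (frameLevel μ K) p‖ ≤ K₁) (hK₂ : ∀ p : Momentum, ‖iteratedFDeriv ℝ 2 (frameLevel μ K) p‖ ≤ K₂)
  (hK₃ : ∀ p : Momentum, ‖iteratedFDeriv ℝ 3 (frameLevel μ K) p‖ ≤ K₃)
include hA hA20 hd hr hlo hhi hA₃ hA₄ hA₅ hA₆ hK₁ hK₂ hK₃

set_option maxHeartbeats 400000 in
/-- **THE SUMMED FIRST-ORDER LAYER FOR THE TRUE pp KERNEL `P/C_P`** (stmt-20437 (C), `M₁`): k3c3-p3's `firstOrderLayer_abs_le` at `Kr(e,u) := ppTrueKernel βT Λ e u / C_P`, `C_P := (12B₁+9) + (64B₂+120B₁+158+(12B₁+5)K_Λ) + (128B₁+72)` (no partition: the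
true kernel itself), its six kernel rows discharged by `ppTrueKernel_firstOrderRows_concrete`; kernel inputs left `0 < βT`, `0 < Λ`, `|χ′| ≤ B₁`, `|χ″| ≤ B₂`, `lo ≤ Λ`,
`1 ≤ K_Λ`, `hi ≤ K_Λ·Λ` (the level box inside `K_Λ` shells); `hUmk` stays (its integrand now carries the concrete kernel).
[cite: BenfattoGiulianiMastropietro2006, §2.4 (2.36)] [cite: FeldmanSalmhoferTrubowitz1998, §3] -/
theorem firstOrderLayer_abs_ppTrue_le {R : RenConsts} {U : ℝ} {N : ℕ} (hF : FrameOK R U N μ K) {Kc r₀ g₀ w : ℝ} (hG : GeomConstants (frameLevel μ K) Kc r₀ g₀ w)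
    {W K₀ : ℝ}
    (hW : W * (2 * K₃ * msD A₃ A₄ 1 ^ 3 + 4 * K₂ * msD A₃ A₄ 1 * msD A₃ A₄ 2 + K₁ * msD A₃ A₄ 3) ≤ 3 / 200 * (bandBounds (show (-4 : ℝ) < -1.1 by norm_num) (show (-1.1 : ℝ) ≤ -0.1 by norm_num) (show (-0.1 : ℝ) < 0 by norm_num)).umin ^ 2)
    (hK₀ : ∀ p : Momentum, |frameLevel μ K p| ≤ K₀)
    {ρ : ℝ} (hρ : |ρ| < r) (θ : ℝ) {κ τ₂ Wϑ : ℝ} (hκ0 : 0 < κ) (hκ : κ ≤ (-μ - A - |ρ|) / (6 * π ^ 2) - A / 8 - A ^ 2 / (4 * (-μ - A - |ρ|)))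
    (hWϑ0 : 0 ≤ Wϑ) (hWϑ : Wϑ ≤ W)
    (hmargin : (|ρ| / 2 + ρ ^ 2 / (4 * (-μ - A - |ρ|)) + Kc * τ₂ / 2) / κ < (2 * (bandBounds (show (-4 : ℝ) < -1.1 by norm_num) (show (-1.1 : ℝ) ≤ -0.1 by norm_num) (show (-0.1 : ℝ) < 0 by norm_num)).umin / π * Wϑ) ^ 2)
    (hvW : π / (4 * (bandBounds (show (-4 : ℝ) < -1.1 by norm_num) (show (-1.1 : ℝ) ≤ -0.1 by norm_num) (show (-0.1 : ℝ) < 0 by norm_num)).umin) * (|ρ| / ((bandBounds (show (-4 : ℝ) < -1.1 by norm_num) (show (-1.1 : ℝ) ≤ -0.1 by norm_num) (show (-0.1 : ℝ) < 0 by norm_num)).Dtmin - 2 * A) + msD A₃ A₄ 1 * Wϑ + τ₂) ≤ W)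
    {δ₀ η₀ s₂ : ℝ} (hδ₀ : 0 < δ₀) (hδ₀π : δ₀ ≤ π / 2)
    (hδrow : (K₃ * msD A₃ A₄ 1 ^ 2 + K₂ * msD A₃ A₄ 2) * msD A₃ A₄ 1 * δ₀ ≤
      (2 / π * (((bandBounds (show (-4 : ℝ) < -1.1 by norm_num) (show (-1.1 : ℝ) ≤ -0.1 by norm_num) (show (-0.1 : ℝ) < 0 by norm_num)).Dtmin - 2 * A) *
        (bandBounds (show (-4 : ℝ) < -1.1 by norm_num) (show (-1.1 : ℝ) ≤ -0.1 by norm_num) (show (-0.1 : ℝ) < 0 by norm_num)).umin) *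
        ((bandBounds (show (-4 : ℝ) < -1.1 by norm_num) (show (-1.1 : ℝ) ≤ -0.1 by norm_num) (show (-0.1 : ℝ) < 0 by norm_num)).umin * w / (4 + 2 * A))) / 2)
    (hη₀ : η₀ ≤ δ₀ / 2)
    (hη₀row : (K₁ * msD A₃ A₄ 2 + K₂ * msD A₃ A₄ 1 ^ 2) * η₀ ≤
      (2 / π * (((bandBounds (show (-4 : ℝ) < -1.1 by norm_num) (show (-1.1 : ℝ) ≤ -0.1 by norm_num) (show (-0.1 : ℝ) < 0 by norm_num)).Dtmin - 2 * A) *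
        (bandBounds (show (-4 : ℝ) < -1.1 by norm_num) (show (-1.1 : ℝ) ≤ -0.1 by norm_num) (show (-0.1 : ℝ) < 0 by norm_num)).umin) *
        ((bandBounds (show (-4 : ℝ) < -1.1 by norm_num) (show (-1.1 : ℝ) ≤ -0.1 by norm_num) (show (-0.1 : ℝ) < 0 by norm_num)).umin * w / (4 + 2 * A))) * δ₀ / 4)
    (hs₂η : π / (2 * (bandBounds (show (-4 : ℝ) < -1.1 by norm_num) (show (-1.1 : ℝ) ≤ -0.1 by norm_num) (show (-0.1 : ℝ) < 0 by norm_num)).umin) * s₂ ≤ η₀)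
    {hi₀ Kd P M lo hi Wt : ℝ} (hP : 0 ≤ P) (hWt : 0 ≤ Wt)
    (hdom : ∀ (hi ρ θ lo : ℝ) (t wt : ℝ → ℝ), 0 < hi → hi ≤ hi₀ → |ρ| < r → 0 < lo → lo ≤ hi → (∀ e ∈ Icc lo hi, e ≤ t e) →
      (∀ e ∈ Icc lo hi, 0 ≤ wt e) → (∀ e ∈ Icc lo hi, wt e ≤ Wt) → ∀ ϑ : ℝ, 0 < FermiRG.torusDist (ϑ - π) →
        (∫ e in lo..hi, wt e * ∫ x in Icc (-π) π, (max (t e) |frameLevel μ K (pairSumPath μ K ρ ϑ θ 0 - levelPoint μ K e (x + θ))|)⁻¹) ≤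
            Kd + P * log⁺ (M / FermiRG.torusDist (ϑ - π)) ∧
          (∫ e in lo..hi, wt e * ∫ x in Icc (-π) π, (max (t e) |frameLevel μ K (pairSumPath μ K ρ ϑ θ 0 - levelPoint μ K (-e) (x + θ))|)⁻¹) ≤
            Kd + P * log⁺ (M / FermiRG.torusDist (ϑ - π)))
    (hlo0 : 0 < lo) (hlohi : lo ≤ hi) (hhi₀ : hi ≤ hi₀) (hhir : hi < r) {wt : ℝ → ℝ}
    (hwc : ContinuousOn wt (Icc (-hi) hi)) (hw0 : ∀ e ∈ Icc (-hi) hi, 0 ≤ wt e) (hwW : ∀ e ∈ Icc (-hi) hi, wt e ≤ Wt)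
    (hτ₂ : 0 < τ₂) (hs₂ : 0 < s₂)
    {Jw : ℝ → ℝ → ℝ} {J₀ J₁ U : ℝ}
    {βT Λ B₁ B₂ KΛ : ℝ} (hkβ : 0 < βT) (hkΛ : 0 < Λ) (hkB₁ : ∀ x, |deriv salmhoferCutoff x| ≤ B₁) (hkB₂ : ∀ x, |deriv (deriv salmhoferCutoff) x| ≤ B₂)
    (hkloΛ : lo ≤ Λ) (hkK : 1 ≤ KΛ) (hkhiK : hi ≤ KΛ * Λ)
    (hJ : ∀ e ∈ Icc (-hi) hi, ContDiff ℝ 1 (Jw e)) (hJb : ∀ e ∈ Icc (-hi) hi, ∀ v, |Jw e v| ≤ J₀) (hJ1 : ∀ e ∈ Icc (-hi) hi, ∀ v, |deriv (Jw e) v| ≤ J₁)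
    (hJper : ∀ e ∈ Icc (-hi) hi, ∀ v, Jw e (v + 2 * π) = Jw e v) (hJ2 : ContinuousOn (fun q : ℝ × ℝ => Jw q.1 q.2) (Icc (-hi) hi ×ˢ univ))
    (hUmk : ∫ ϑ in (0 : ℝ)..(2 * π), |∫ e in (-hi)..hi, ∫ v in (-π)..π, wt e *
      (umkDirCut μ K ρ θ τ₂ ϑ v * umkCooperCut μ K ρ θ s₂ ϑ * Jw e v * ((fderiv ℝ (frameLevel μ K) (pairSumPath μ K ρ ϑ θ 0 - levelPoint μ K e (v + θ)))
          (iteratedDeriv 1 (levelPoint μ K 0) θ + iteratedDeriv 1 (levelPoint μ K ρ) (ϑ + θ))) * deriv (fun v : ℝ => ppTrueKernel βT Λ e v / (12 * B₁ + 9 + (64 * B₂ + 120 * B₁ + 158 + (12 * B₁ + 5) * KΛ) + (128 * B₁ + 72))) (frameLevel μ K (pairSumPath μ K ρ ϑ θ 0 - levelPoint μ K e (v + θ))))| ≤ U) :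
    ∫ ϑ in Ioc 0 (2 * π), |∫ e in (-hi)..hi, wt e * ∫ v in (-π)..π,
        Jw e v * ((fderiv ℝ (frameLevel μ K) (pairSumPath μ K ρ ϑ θ 0 - levelPoint μ K e (v + θ)))
          (iteratedDeriv 1 (levelPoint μ K 0) θ + iteratedDeriv 1 (levelPoint μ K ρ) (ϑ + θ))) * deriv (fun v : ℝ => ppTrueKernel βT Λ e v / (12 * B₁ + 9 + (64 * B₂ + 120 * B₁ + 158 + (12 * B₁ + 5) * KΛ) + (128 * B₁ + 72))) (frameLevel μ K (pairSumPath μ K ρ ϑ θ 0 - levelPoint μ K e (v + θ)))| ≤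
      U + (J₀ * ((6 * (max (max K₀ K₁) (max K₂ K₃)) * (max 1 (max (4 * msD A₃ A₄ 1) (max (6 * msD A₃ A₄ 2) (10 * msD A₃ A₄ 3)))) ^ 3) / (2 * (3 / 400 * (bandBounds (show (-4 : ℝ) < -1.1 by norm_num) (show (-1.1 : ℝ) ≤ -0.1 by norm_num) (show (-0.1 : ℝ) < 0 by norm_num)).umin ^ 2)) + ((6 * (max (max K₀ K₁) (max K₂ K₃)) * (max 1 (max (4 * msD A₃ A₄ 1) (max (6 * msD A₃ A₄ 2) (10 * msD A₃ A₄ 3)))) ^ 3) / (2 * (3 / 400 * (bandBounds (show (-4 : ℝ) < -1.1 by norm_num) (show (-1.1 : ℝ) ≤ -0.1 by norm_num) (show (-0.1 : ℝ) < 0 by norm_num)).umin ^ 2)) * ((max (max K₀ K₁) (max K₂ K₃)) * max (1 / ((bandBounds (show (-4 : ℝ) < -1.1 by norm_num) (show (-1.1 : ℝ) ≤ -0.1 by norm_num) (show (-0.1 : ℝ) < 0 by norm_num)).Dtmin - 2 * A)) (radialRowOneConst A ((bandBounds (show (-4 : ℝ) < -1.1 by norm_num) (show (-1.1 : ℝ)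 ≤ -0.1 by norm_num) (show (-0.1 : ℝ) < 0 by norm_num)).Dtmin - 2 * A))) + (1 + 1 : ℕ).factorial * (max (max K₀ K₁) (max K₂ K₃)) * max (1 / ((bandBounds (show (-4 : ℝ) < -1.1 by norm_num) (show (-1.1 : ℝ) ≤ -0.1 by norm_num) (show (-0.1 : ℝ) < 0 by norm_num)).Dtmin - 2 * A)) (radialRowOneConst A ((bandBounds (show (-4 : ℝ) < -1.1 by norm_num) (show (-1.1 : ℝ) ≤ -0.1 by norm_num) (show (-0.1 : ℝ) < 0 by norm_num)).Dtmin - 2 * A)) * (max 1 (3 * msD A₃ A₄ 1 + r * radialRowOneConst A ((bandBounds (show (-4 : ℝ) < -1.1 by norm_num) (show (-1.1 : ℝ) ≤ -0.1 by norm_num) (show (-0.1 : ℝ) < 0 by norm_num)).Dtmin - 2 * A))) ^ 1) + ((6 * (max (max K₀ K₁) (max K₂ K₃)) * (max 1 (max (4 * msD A₃ A₄ 1) (max (6 * msD A₃ A₄ 2) (10 * msD A₃ A₄ 3)))) ^ 3) / (2 * (3 / 400 * (bandBounds (show (-4 : ℝ) < -1.1 by norm_num) (show (-1.1 : ℝ)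 ≤ -0.1 by norm_num) (show (-0.1 : ℝ) < 0 by norm_num)).umin ^ 2)) * ((max (max K₀ K₁) (max K₂ K₃)) * max (1 / ((bandBounds (show (-4 : ℝ) < -1.1 by norm_num) (show (-1.1 : ℝ) ≤ -0.1 by norm_num) (show (-0.1 : ℝ) < 0 by norm_num)).Dtmin - 2 * A)) (radialRowOneConst A ((bandBounds (show (-4 : ℝ) < -1.1 by norm_num) (show (-1.1 : ℝ) ≤ -0.1 by norm_num) (show (-0.1 : ℝ) < 0 by norm_num)).Dtmin - 2 * A))) + (1 + 1 : ℕ).factorial * (max (max K₀ K₁) (max K₂ K₃)) * max (1 / ((bandBounds (show (-4 : ℝ) < -1.1 by norm_num) (show (-1.1 : ℝ) ≤ -0.1 by norm_num) (show (-0.1 : ℝ) < 0 by norm_num)).Dtmin - 2 * A)) (radialRowOneConst A ((bandBounds (show (-4 : ℝ) < -1.1 by norm_num) (show (-1.1 : ℝ) ≤ -0.1 by norm_num) (show (-0.1 : ℝ) < 0 by norm_num)).Dtmin - 2 * A)) * (max 1 (3 * msD A₃ A₄ 1 + r * radialRowOneConst A ((bandBounds (show (-4 : ℝ) < -1.1 by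 norm_num) (show (-1.1 : ℝ) ≤ -0.1 by norm_num) (show (-0.1 : ℝ) < 0 by norm_num)).Dtmin - 2 * A))) ^ 1) * (|ρ| / lo)) + (24 * msD A₃ A₄ 1 / τ₂ * J₀ + J₁)) *
        (2 * (2 * π * (Kd + P * (1 + log⁺ (M / π)))) + 2 * π * (4 * π * Wt)) +
        (J₀ * (max ((K₂ * msD A₃ A₄ 1 * msD A₃ A₄ 2 + (K₃ * msD A₃ A₄ 1 ^ 2 + K₂ * msD A₃ A₄ 2) * msD A₃ A₄ 1) /
            ((2 / π * (((bandBounds (show (-4 : ℝ) < -1.1 by norm_num) (show (-1.1 : ℝ) ≤ -0.1 by norm_num) (show (-0.1 : ℝ) < 0 by norm_num)).Dtmin - 2 * A) *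
        (bandBounds (show (-4 : ℝ) < -1.1 by norm_num) (show (-1.1 : ℝ) ≤ -0.1 by norm_num) (show (-0.1 : ℝ) < 0 by norm_num)).umin) *
        ((bandBounds (show (-4 : ℝ) < -1.1 by norm_num) (show (-1.1 : ℝ) ≤ -0.1 by norm_num) (show (-0.1 : ℝ) < 0 by norm_num)).umin * w / (4 + 2 * A))) / 2))
          ((K₁ * msD A₃ A₄ 2 + K₂ * msD A₃ A₄ 1 * msD A₃ A₄ 1) /
            ((2 / π * (((bandBounds (show (-4 : ℝ) < -1.1 by norm_num) (show (-1.1 : ℝ) ≤ -0.1 by norm_num) (show (-0.1 : ℝ) < 0 by norm_num)).Dtmin - 2 * A) *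
        (bandBounds (show (-4 : ℝ) < -1.1 by norm_num) (show (-1.1 : ℝ) ≤ -0.1 by norm_num) (show (-0.1 : ℝ) < 0 by norm_num)).umin) *
        ((bandBounds (show (-4 : ℝ) < -1.1 by norm_num) (show (-1.1 : ℝ) ≤ -0.1 by norm_num) (show (-0.1 : ℝ) < 0 by norm_num)).umin * w / (4 + 2 * A))) * δ₀ / 4)) +
        (max ((K₂ * msD A₃ A₄ 1 * msD A₃ A₄ 2 + (K₃ * msD A₃ A₄ 1 ^ 2 + K₂ * msD A₃ A₄ 2) * msD A₃ A₄ 1) /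
            ((2 / π * (((bandBounds (show (-4 : ℝ) < -1.1 by norm_num) (show (-1.1 : ℝ) ≤ -0.1 by norm_num) (show (-0.1 : ℝ) < 0 by norm_num)).Dtmin - 2 * A) *
        (bandBounds (show (-4 : ℝ) < -1.1 by norm_num) (show (-1.1 : ℝ) ≤ -0.1 by norm_num) (show (-0.1 : ℝ) < 0 by norm_num)).umin) *
        ((bandBounds (show (-4 : ℝ) < -1.1 by norm_num) (show (-1.1 : ℝ) ≤ -0.1 by norm_num) (show (-0.1 : ℝ) < 0 by norm_num)).umin * w / (4 + 2 * A))) / 2))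
          ((K₁ * msD A₃ A₄ 2 + K₂ * msD A₃ A₄ 1 * msD A₃ A₄ 1) /
            ((2 / π * (((bandBounds (show (-4 : ℝ) < -1.1 by norm_num) (show (-1.1 : ℝ) ≤ -0.1 by norm_num) (show (-0.1 : ℝ) < 0 by norm_num)).Dtmin - 2 * A) *
        (bandBounds (show (-4 : ℝ) < -1.1 by norm_num) (show (-1.1 : ℝ) ≤ -0.1 by norm_num) (show (-0.1 : ℝ) < 0 by norm_num)).umin) *
        ((bandBounds (show (-4 : ℝ) < -1.1 by norm_num) (show (-1.1 : ℝ) ≤ -0.1 by norm_num) (show (-0.1 : ℝ) < 0 by norm_num)).umin * w / (4 + 2 * A))) * δ₀ / 4)) *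
          ((max K₁ K₂) * max (1 / ((bandBounds (show (-4 : ℝ) < -1.1 by norm_num) (show (-1.1 : ℝ) ≤ -0.1 by norm_num) (show (-0.1 : ℝ) < 0 by norm_num)).Dtmin - 2 * A))
            (radialRowOneConst A ((bandBounds (show (-4 : ℝ) < -1.1 by norm_num) (show (-1.1 : ℝ) ≤ -0.1 by norm_num) (show (-0.1 : ℝ) < 0 by norm_num)).Dtmin - 2 * A))) +
        2 * (max K₁ K₂) *
          max (1 / ((bandBounds (show (-4 : ℝ) < -1.1 by norm_num) (show (-1.1 : ℝ) ≤ -0.1 by norm_num) (show (-0.1 : ℝ) < 0 by norm_num)).Dtmin - 2 * A))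
            (radialRowOneConst A ((bandBounds (show (-4 : ℝ) < -1.1 by norm_num) (show (-1.1 : ℝ) ≤ -0.1 by norm_num) (show (-0.1 : ℝ) < 0 by norm_num)).Dtmin - 2 * A)) *
          (max 1 (3 * msD A₃ A₄ 1 + r * radialRowOneConst A ((bandBounds (show (-4 : ℝ) < -1.1 by norm_num) (show (-1.1 : ℝ) ≤ -0.1 by norm_num) (show (-0.1 : ℝ) < 0 by norm_num)).Dtmin - 2 * A)))) +
        (max ((K₂ * msD A₃ A₄ 1 * msD A₃ A₄ 2 + (K₃ * msD A₃ A₄ 1 ^ 2 + K₂ * msD A₃ A₄ 2) * msD A₃ A₄ 1) /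
            ((2 / π * (((bandBounds (show (-4 : ℝ) < -1.1 by norm_num) (show (-1.1 : ℝ) ≤ -0.1 by norm_num) (show (-0.1 : ℝ) < 0 by norm_num)).Dtmin - 2 * A) *
        (bandBounds (show (-4 : ℝ) < -1.1 by norm_num) (show (-1.1 : ℝ) ≤ -0.1 by norm_num) (show (-0.1 : ℝ) < 0 by norm_num)).umin) *
        ((bandBounds (show (-4 : ℝ) < -1.1 by norm_num) (show (-1.1 : ℝ) ≤ -0.1 by norm_num) (show (-0.1 : ℝ) < 0 by norm_num)).umin * w / (4 + 2 * A))) / 2))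
          ((K₁ * msD A₃ A₄ 2 + K₂ * msD A₃ A₄ 1 * msD A₃ A₄ 1) /
            ((2 / π * (((bandBounds (show (-4 : ℝ) < -1.1 by norm_num) (show (-1.1 : ℝ) ≤ -0.1 by norm_num) (show (-0.1 : ℝ) < 0 by norm_num)).Dtmin - 2 * A) *
        (bandBounds (show (-4 : ℝ) < -1.1 by norm_num) (show (-1.1 : ℝ) ≤ -0.1 by norm_num) (show (-0.1 : ℝ) < 0 by norm_num)).umin) *
        ((bandBounds (show (-4 : ℝ) < -1.1 by norm_num) (show (-1.1 : ℝ) ≤ -0.1 by norm_num) (show (-0.1 : ℝ) < 0 by norm_num)).umin * w / (4 + 2 * A))) * δ₀ / 4)) *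
          ((max K₁ K₂) * max (1 / ((bandBounds (show (-4 : ℝ) < -1.1 by norm_num) (show (-1.1 : ℝ) ≤ -0.1 by norm_num) (show (-0.1 : ℝ) < 0 by norm_num)).Dtmin - 2 * A))
            (radialRowOneConst A ((bandBounds (show (-4 : ℝ) < -1.1 by norm_num) (show (-1.1 : ℝ) ≤ -0.1 by norm_num) (show (-0.1 : ℝ) < 0 by norm_num)).Dtmin - 2 * A))) +
        2 * (max K₁ K₂) *
          max (1 / ((bandBounds (show (-4 : ℝ) < -1.1 by norm_num) (show (-1.1 : ℝ) ≤ -0.1 by norm_num) (show (-0.1 : ℝ) < 0 by norm_num)).Dtmin - 2 * A))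
            (radialRowOneConst A ((bandBounds (show (-4 : ℝ) < -1.1 by norm_num) (show (-1.1 : ℝ) ≤ -0.1 by norm_num) (show (-0.1 : ℝ) < 0 by norm_num)).Dtmin - 2 * A)) *
          (max 1 (3 * msD A₃ A₄ 1 + r * radialRowOneConst A ((bandBounds (show (-4 : ℝ) < -1.1 by norm_num) (show (-1.1 : ℝ) ≤ -0.1 by norm_num) (show (-0.1 : ℝ) < 0 by norm_num)).Dtmin - 2 * A)))) * (|ρ| / lo)) + (24 * msD A₃ A₄ 1 / τ₂ * J₀ + J₁)) *
        (2 * (2 * π * (Kd + P * (1 + log⁺ (M / π)))) + 2 * π * (4 * π * Wt)) := by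
  obtain ⟨rKd, rKc, rK0, rK0s, rK1, rKs1⟩ :=
    ppTrueKernel_firstOrderRows_concrete (hi := hi) hkβ hkΛ hkB₁ hkB₂ hlo0 hkloΛ hkK hkhiK
  exact firstOrderLayer_abs_le hA hA20 hd hr hlo hhi hA₃ hA₄ hA₅ hA₆ hK₁ hK₂ hK₃
    (Kr := fun e u => ppTrueKernel βT Λ e u / (12 * B₁ + 9 + (64 * B₂ + 120 * B₁ + 158 + (12 * B₁ + 5) * KΛ) + (128 * B₁ + 72)))
    hF hG hW hK₀ hρ θ hκ0 hκ hWϑ0 hWϑ hmargin hvW hδ₀ hδ₀π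
    hδrow hη₀ hη₀row hs₂η hP hWt hdom hlo0 hlohi hhi₀ hhir hwc hw0 hwW
    hτ₂ hs₂ hJ hJb hJ1 hJper hJ2 rKd rKc rK0 rK0s rK1 rKs1 hUmk

end Sizes

end Summit.HubbardSuperconductivity.HubbardSuperconductivity.Theorems.C4a

end
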